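import Summits.HubbardSuperconductivity.HubbardSuperconductivity.Theorems.NoGoNogoThesis
import Literature.MathematicalPhysics.QuantumLattice.HubbardTorus2DEnergyDensity
import Literature.MathematicalPhysics.QuantumLattice.PairCorrelations

/-!
# Route `KacWindowPenalty` — crux `WindowGap` (stmt-HubbardSuperconductivity-1088): the BASE of line
# `parabolic-descent` reduced to one certified floor against the thermodynamic energy density

Supports for the crux, line `Sketch` (idea `parabolic-descent`; registered skeleton
`Cruxes/WindowGap/Lines/Sketch.lean`). The line's only open stub `stub_localCertificate` asks, in its
clause (i) BASE, for an extensive excess of the sector ground energy of the LOCALLY perturbed torus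
`H_L + λ⋆ Σ_x P_xᴴ P_x` (`P_x = localPair dWaveFormFactor L x`) over that of `H_L = hubbardTorus 2 L 1 U`
in the sector `K_L = szSector N_L 0`, `N_L = 2⌊(1−δ)L²/2⌋`, uniformly in large even `L`. This file
turns BASE into the form a certified-numerics SUPPLIER would deliver (`baseGapLocal_of_certifiedFloor`):

  ONE uniform certified floor `e_lo L² ≤ minE(H_L + λ⋆ Σ_x P_xᴴP_x | K_L)` (all large even `L`) with
  `e(1, U, 1−δ) + λ⋆A⋆ < e_lo`,

where `e(t, U, n) = energyDensity2D t U n` is the tree's thermodynamic limit of the canonical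
ground-state energy density of the 2D Hubbard torus (`tendsto_energyDensity2D_torus`, Ruelle 1969
§3.3 via Fekete). Ingredients: `minE(H_L | K_L) = E_{torus L}(N_L)` (the `N`-particle ground energy is
attained at `S^z = 0`, `groundEnergyAt_eq_minEnergyOn_szSector`, Lieb 1989) and `N_L = rectN (1−δ) L`
(`rfl`), so `minE(H_L | K_L)/L² → e(1, U, 1−δ)` (`tendsto_minEnergyOn_hubbardTorus_szSector_div_sq`).
No definitions, no named facts, no physics: the certified floor and the strict inequality ARE the
physics (open; precision law of the crux NOTES: the needed margin is `λ⋆·(room) ≈ λ⋆m²`).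
Sources: D. Ruelle, *Statistical Mechanics* (1969) §3.3; E. H. Lieb, PRL 62 (1989) 1201, proof of
Thm 1; Wang et al., arXiv:2310.05844, §II (certified lower bounds on ground-energy densities).
-/

-- the mandated namespace `Summit.<Summit>.<Problem>.Theorems` repeats `HubbardSuperconductivity`
-- (single-problem summit, D-0017), which the `dupNamespace` linter flags on every declaration
set_option linter.dupNamespace false

namespace Summit.HubbardSuperconductivity.HubbardSuperconductivity.Theorems

open Matrix Filter Topology Literature.MathematicalPhysics.QuantumLattice
open Literature.MathematicalPhysics.QuantumLattice.ThermodynamicLimit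

/-- **The sector ground energy per site converges to the thermodynamic energy density.** For
`U ≥ 0` and `δ ∈ (0, 1/2)`: `minE(hubbardTorus 2 L 1 U | szSector N_L 0)/L² → e(1, U, 1−δ)`,
`N_L = 2⌊(1−δ)L²/2⌋ = rectN (1−δ) L`; the sector minimum is the `N_L`-particle ground energy
(`groundEnergyAt_eq_minEnergyOn_szSector`, every spin multiplet has an `S^z = 0` member) and the
latter converges per site (`tendsto_energyDensity2D_torus`). Ruelle (1969) §3.3; Lieb, PRL 62 (1989)
1201. [folklore] -/
theorem tendsto_minEnergyOn_hubbardTorus_szSector_div_sq {U δ : ℝ} (hU : 0 ≤ U)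
    (hδ : δ ∈ Set.Ioo (0 : ℝ) (1 / 2)) :
    Tendsto (fun L : ℕ => (hubbardTorus 2 L 1 U).minEnergyOn
        (szSector (2 * ⌊(1 - δ) * (L : ℝ) ^ 2 / 2⌋₊) 0) / (L : ℝ) ^ 2)
      atTop (𝓝 (energyDensity2D 1 U (1 - δ))) := by
  have hlim := tendsto_energyDensity2D_torus 1 hU (n := 1 - δ) (by linarith [hδ.2]) (by linarith [hδ.1])
  refine hlim.congr fun L => ?_
  have hn : ⌊(1 - δ) * (L : ℝ) ^ 2 / 2⌋₊ ≤ Fintype.card (FermionTorus 2 L) := by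
    rw [Summit.HubbardSuperconductivity.NoGo.card_fermionTorus_two]
    exact Summit.HubbardSuperconductivity.NoGo.floor_pairNumber_le δ (by linarith [hδ.1]) L
  have h := groundEnergyAt_eq_minEnergyOn_szSector (fermionTorusGraph 2 L) 1 U hn
  show groundEnergyAt (fermionTorusGraph 2 L) 1 U (rectN (1 - δ) L) / (L : ℝ) ^ 2 = _
  rw [rectN, h]
  rfl

/-- **BASE from one certified floor** (supplier interface for clause (i) of the line's physics stub).
If `U ≥ 0`, `δ ∈ (0, 1/2)`, a real `e_lo` bounds the locally-penalised sector ground energy from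
below, `e_lo L² ≤ minE(H_L + λ⋆ Σ_x P_xᴴ P_x | K_L)` for all large even `L`, and `e_lo` exceeds the
thermodynamic energy density of the pure model by the margin, `e(1, U, 1−δ) + λ⋆A⋆ < e_lo`, then the
base inequality `λ⋆ A⋆ L² ≤ minE(H_L + λ⋆ Σ_x P_xᴴP_x | K_L) − minE(H_L | K_L)` holds for all large
even `L` (since `minE(H_L | K_L)/L² → e(1, U, 1−δ)`, eventually `minE(H_L | K_L) ≤ (e_lo − λ⋆A⋆)L²`).
Ruelle (1969) §3.3; Wang et al., arXiv:2310.05844, §II. [folklore] -/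
theorem baseGapLocal_of_certifiedFloor {U δ lams As elo : ℝ} (hU : 0 ≤ U)
    (hδ : δ ∈ Set.Ioo (0 : ℝ) (1 / 2))
    (hfloor : ∃ L₀ : ℕ, ∀ (L : ℕ) [NeZero L], L₀ ≤ L → Even L →
      elo * (L : ℝ) ^ 2 ≤
        (hubbardTorus 2 L 1 U + (lams : ℂ) •
            ∑ x : Fin 2 → ZMod L, (localPair dWaveFormFactor L x)ᴴ * localPair dWaveFormFactor L x).minEnergyOn
          (szSector (2 * ⌊(1 - δ) * (L : ℝ) ^ 2 / 2⌋₊) 0))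
    (hstrict : energyDensity2D 1 U (1 - δ) + lams * As < elo) :
    ∃ L₀ : ℕ, ∀ (L : ℕ) [NeZero L], L₀ ≤ L → Even L →
      lams * As * (L : ℝ) ^ 2 ≤
        (hubbardTorus 2 L 1 U + (lams : ℂ) •
            ∑ x : Fin 2 → ZMod L, (localPair dWaveFormFactor L x)ᴴ * localPair dWaveFormFactor L x).minEnergyOn
            (szSector (2 * ⌊(1 - δ) * (L : ℝ) ^ 2 / 2⌋₊) 0) -
          (hubbardTorus 2 L 1 U).minEnergyOn (szSector (2 * ⌊(1 - δ) * (L : ℝ) ^ 2 / 2⌋₊) 0) := by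
  obtain ⟨L₀, hL₀⟩ := hfloor
  -- eventually the pure sector energy per site is below `elo − λ⋆A⋆`
  have hev : ∀ᶠ L : ℕ in atTop, (hubbardTorus 2 L 1 U).minEnergyOn
      (szSector (2 * ⌊(1 - δ) * (L : ℝ) ^ 2 / 2⌋₊) 0) / (L : ℝ) ^ 2 < elo - lams * As :=
    (tendsto_minEnergyOn_hubbardTorus_szSector_div_sq hU hδ).eventually
      (gt_mem_nhds (by linarith))
  obtain ⟨L₁, hL₁⟩ := Filter.eventually_atTop.1 hev
  refine ⟨max L₀ L₁, fun L _ hL hE => ?_⟩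
  have hLpos : (0 : ℝ) < (L : ℝ) ^ 2 := by
    have : (0 : ℝ) < (L : ℝ) := Nat.cast_pos.2 (Nat.pos_of_ne_zero (NeZero.ne L))
    positivity
  have h1 := hL₀ L (le_of_max_le_left hL) hE
  have h2 := hL₁ L (le_of_max_le_right hL)
  rw [div_lt_iff₀ hLpos] at h2
  nlinarith

end Summit.HubbardSuperconductivity.HubbardSuperconductivity.Theorems
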